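import Literature.NumberTheory.Rogawski1990.CartanInvariant
import HarnessLib

/-!
# The stable class of a SPLIT-torus element of `U(H)` is a single conjugacy class: «`𝔇(T∕F) = 1`» for `T ≅ E^× × E¹ ⊂ U(3)`
# and `T ≅ E^× ⊂ U(1,1)`, in form language over any commutative ring with involution
(Rogawski (1990), §3.1 p. 19 «`𝔇(I∕F)` parametrizes the conjugacy classes within the stable conjugacy class», §3.5 Prop. 3.5.2
p. 29, §3.6 p. 31 «the maximally split Cartan subgroup `T = M`, `H¹(F, T) → H¹(F, G)` injective»; Kottwitz (1986) §7)

Topic `NumberTheory/Rogawski1990`; namespace `Literature.NumberTheory.Rogawski1990`.  THEOREMS ONLY (no definition, no instance,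
no notation, no named fact, no `sorry`).  Cell `pub/hodgecm-mathlib`, programme P3a, road «D-N7-inert» (inert unit fundamental lemma
[Rogawski1990, Prop. 4.9.1 (b)], map of record A-p06 (g25) §3 (L8) «non-elliptic ∕ Levi classes»), brick «(D-N7-inert) JUNCTION-Levi»
FILE A1 (LEAD F0P3a-plan (g9) T8-20 (D)(1); cut-holder F0P3b-p01 (g6)).  HONEST LABEL: HC_CM is proved only modulo the 2 remaining
named inputs (hLiu418, h413) until rung 0 closes; this file is unconditional matrix algebra and proves no letter.

THE MATHEMATICS.  By ★ `CartanInvariant.exists_unitary_conj_iff_exists_commute_congr_eq`, stably conjugate `γ, δ = g γ g⁻¹ ∈ U(H)(R)`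
(`g ∈ GL_n(R)`) are `U(H)(R)`-conjugate iff some `t ∈ Z_{GL_n(R)}(γ)` carries the transported form `H_g = ᵗ(σg) H g` back to `H`.
For `γ` with an EIGENFRAME `γ P = P · diag(d)`, every `γ`-invariant form has frame Gram matrix `Q = ᵗ(σP) M P` satisfying
`(σ(dᵢ) dⱼ − 1) Qᵢⱼ = 0` (§1).  On the SPLIT-TORUS stratum — `d = (α, u, σ(α)⁻¹)` for `U(3)`, resp. `d = (α, σ(α)⁻¹)` for `U(2)`, with
`σ(dᵢ) dⱼ − 1` a unit off the pattern `{(0,2),(1,1),(2,0)}`, resp. `{(0,1),(1,0)}` (regularity: `u ≠ α`, `N(α) ≠ 1` at every factor) —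
both `Q = H_P` and `Q′ = H_{gP}` are supported on that pattern: the `α`- and `σ(α)⁻¹`-eigenlines are ISOTROPIC and pair to a
hyperbolic plane, the `u`-line is its orthogonal complement; comparing determinants, the middle entries differ by the NORM
`N(c′∕(c · det g))`, so the explicit diagonal-in-the-frame `t = P · diag(1, c′∕(c det g), c∕c′) · P⁻¹ ∈ Z(γ)` (resp. `P · diag(1, c∕c′) · P⁻¹`)
does it.  Hence the stable class of such a `γ` is ONE `U(H)(R)`-class — Rogawski's «`𝔇(T∕F) = ker(H¹(F,T) → H¹(F,G)) = 1`» for the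
maximally split torus, with no cohomology and over ANY commutative ring `R` (applied at `R = ∏_{w∣v} L_w`, `v` non-split, by the
JUNCTION-Levi files: there it discharges BOTH uniqueness binders of ★ `UnitFundamentalLemmaInertResiduallyRegular` §1 on the Levi
stratum, with no residual-regularity and no integrality hypothesis).

§1 `sub_one_mul_frameGram_apply_eq_zero`, `frameGram_apply_eq_zero_of_isUnit` (zero pattern, any `n`); §2 **`isConj_of_isStablyConj_of_splitFrame_three`**
(`N = 3`); §3 **`isConj_of_isStablyConj_of_splitFrame_two`** (`N = 2`).  NOT here: elliptic tori (★ `LocalStableClassesNonsplit`), orbital integrals.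

## References
* [Rogawski1990] J. D. Rogawski, *Automorphic Representations of Unitary Groups in Three Variables*, Ann. of Math. Stud. 123 (1990),
  §3.1 p. 19, §3.5 Prop. 3.5.2 p. 29, §3.6 p. 31, §4.9 p. 55.
* [Kottwitz1986] R. E. Kottwitz, *Stable trace formula: elliptic singular terms*, Math. Ann. 275 (1986), §7.
-/

set_option autoImplicit false

noncomputable section

namespace Literature.NumberTheory.Rogawski1990

open scoped MatrixGroups Matrix
open Matrix
open Literature.AlgebraicGeometry.ShimuraVarieties (unitaryGroup mem_unitaryGroup_iff)

/-! ## §1 The frame Gram matrix of an invariant form and its zero pattern -/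

section FrameGram

variable {R : Type*} [CommRing R] (σ : R →+* R) {n : Type*} [Fintype n] [DecidableEq n]

/-- **The zero pattern of an invariant form in an eigenframe**: if `ᵗ(σγ) M γ = M` and `γ P = P · diag(d)`, then the Gram matrix
`Q = ᵗ(σP) M P` of `M` in the frame `P` satisfies `(σ(dᵢ) dⱼ − 1) · Qᵢⱼ = 0` — eigenvectors for eigenvalues `λ, μ` with `σ(λ) μ ≠ 1` are
`M`-orthogonal. [cite: Rogawski1990, §3.5 p. 29] -/
theorem sub_one_mul_frameGram_apply_eq_zero {M γ P : Matrix n n R} {d : n → R}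
    (hM : (γ.map σ)ᵀ * M * γ = M) (hP : γ * P = P * diagonal d) (i j : n) :
    (σ (d i) * d j - 1) * ((P.map σ)ᵀ * M * P) i j = 0 := by
  have h1 : ((γ * P).map σ)ᵀ * M * (γ * P) = (P.map σ)ᵀ * M * P := by
    rw [Matrix.map_mul, transpose_mul]
    calc (P.map σ)ᵀ * (γ.map σ)ᵀ * M * (γ * P) = (P.map σ)ᵀ * ((γ.map σ)ᵀ * M * γ) * P := by
          simp only [Matrix.mul_assoc]
      _ = (P.map σ)ᵀ * M * P := by rw [hM]
  have h2 : ((γ * P).map σ)ᵀ * M * (γ * P) =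
      diagonal (fun k => σ (d k)) * ((P.map σ)ᵀ * M * P) * diagonal d := by
    rw [hP, Matrix.map_mul, transpose_mul, diagonal_map (map_zero σ), diagonal_transpose]
    simp only [Matrix.mul_assoc]
  have h3 := congrFun (congrFun (h1.symm.trans h2) i) j
  rw [mul_diagonal, diagonal_mul] at h3
  -- h3 : Q i j = σ (d i) * Q i j * d j
  linear_combination -h3

/-- **Off-pattern entries of the frame Gram matrix VANISH**: if `σ(dᵢ) dⱼ − 1` is a unit then `Qᵢⱼ = 0` (eigenvectors for eigenvalues
`λ, μ` with `σ(λ) μ − 1` invertible are `M`-orthogonal). [cite: Rogawski1990, §3.5 p. 29] -/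
theorem frameGram_apply_eq_zero_of_isUnit {M γ P : Matrix n n R} {d : n → R}
    (hM : (γ.map σ)ᵀ * M * γ = M) (hP : γ * P = P * diagonal d) {i j : n} (hij : IsUnit (σ (d i) * d j - 1)) :
    ((P.map σ)ᵀ * M * P) i j = 0 := by
  have h := sub_one_mul_frameGram_apply_eq_zero σ hM hP i j
  obtain ⟨w, hw⟩ := hij
  rw [← hw] at h
  simpa using (Units.mul_right_eq_zero w).1 h

end FrameGram

/-! ## §2 `N = 3`: the split torus `T ≅ E^× × E¹` of `U(3)` -/

section Three

variable {R : Type*} [CommRing R] (σ : R →+* R) (H : Matrix (Fin 3) (Fin 3) R)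

/-- **ONE CLASS IN THE STABLE CLASS ON THE SPLIT-TORUS STRATUM (`N = 3`)** — «`𝔇_G(T∕F) = 1` for the maximally split torus
`T ≅ E^× × E¹` of `U(3)`» in form language, over ANY commutative ring `R` with an involution `σ` and ANY `σ`-hermitian `H` with unit
determinant: if `γ ∈ U(H)(R)` has an eigenframe `γ P = P · diag(d₀, d₁, d₂)` (`P ∈ GL₃(R)`) whose eigenvalues satisfy the split-torus
pattern — `σ(dᵢ) dⱼ − 1` is a UNIT for `(i,j) ∉ {(0,2), (1,1), (2,0)}` (for `d = (α, u, σ(α)⁻¹)`: `u ≠ α` and `N(α) ≠ 1` at every factor) —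
then every `δ ∈ U(H)(R)` stably conjugate to `γ` (★ `IsStablyConj`: `GL₃(R)`-conjugate) is conjugate to `γ` IN `U(H)(R)`.  Proof: by ★
`exists_unitary_conj_iff_exists_commute_congr_eq` it suffices to find `t ∈ Z(γ)` with `ᵗ(σt) H_g t = H`; in the frame both `H` and
`H_g` are `[[0,0,c],[0,x,0],[σc,0,0]]`-shaped (`frameGram_apply_eq_zero_of_isUnit`), their middle entries differ by the NORM
`N(c′∕(c · det g))` (determinants), and `t = P · diag(1, c′∕(c det g), c∕c′) · P⁻¹` does it. [cite: Rogawski1990, §3.1 p. 19; §3.5 Prop. 3.5.2 p. 29; §3.6 p. 31]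
[cite: Kottwitz1986, §7] -/
theorem isConj_of_isStablyConj_of_splitFrame_three (hσ : ∀ r : R, σ (σ r) = r) (hH : (H.map σ)ᵀ = H) (hHd : IsUnit H.det)
    {γ δ : unitaryGroup σ H} (h : IsStablyConj σ H γ δ) (P : GL (Fin 3) R) {d : Fin 3 → R}
    (hP : ((γ : GL (Fin 3) R) : Matrix (Fin 3) (Fin 3) R) * (P : Matrix (Fin 3) (Fin 3) R) =
      (P : Matrix (Fin 3) (Fin 3) R) * diagonal d)
    (h00 : IsUnit (σ (d 0) * d 0 - 1)) (h01 : IsUnit (σ (d 0) * d 1 - 1)) (h10 : IsUnit (σ (d 1) * d 0 - 1))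
    (h12 : IsUnit (σ (d 1) * d 2 - 1)) (h21 : IsUnit (σ (d 2) * d 1 - 1)) (h22 : IsUnit (σ (d 2) * d 2 - 1)) :
    IsConj γ δ := by
  obtain ⟨g, hg⟩ := isStablyConj_iff.mp h
  -- Step A: the form criterion of ★ `CartanInvariant`
  suffices hs : ∃ t : GL (Fin 3) R, t * (γ : GL (Fin 3) R) = γ * t ∧
      ((t : Matrix (Fin 3) (Fin 3) R).map σ)ᵀ * twistGram σ H ((g : GL (Fin 3) R) : Matrix (Fin 3) (Fin 3) R) *
        (t : Matrix (Fin 3) (Fin 3) R) = H by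
    obtain ⟨u, hu, huc⟩ := (exists_unitary_conj_iff_exists_commute_congr_eq σ H hg).2 hs
    refine isConj_iff.2 ⟨⟨u, hu⟩, Subtype.ext ?_⟩
    simpa using huc
  -- Step B: the two frame Gram matrices and their zero patterns
  set Pm : Matrix (Fin 3) (Fin 3) R := (P : Matrix (Fin 3) (Fin 3) R) with hPm
  set Pi : Matrix (Fin 3) (Fin 3) R := ((P⁻¹ : GL (Fin 3) R) : Matrix (Fin 3) (Fin 3) R) with hPi
  set G' : Matrix (Fin 3) (Fin 3) R := twistGram σ H ((g : GL (Fin 3) R) : Matrix (Fin 3) (Fin 3) R) with hG'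
  set Q : Matrix (Fin 3) (Fin 3) R := (Pm.map σ)ᵀ * H * Pm with hQ
  set Q' : Matrix (Fin 3) (Fin 3) R := (Pm.map σ)ᵀ * G' * Pm with hQ'
  have hγH : ((((γ : GL (Fin 3) R)) : Matrix (Fin 3) (Fin 3) R).map σ)ᵀ * H * ((γ : GL (Fin 3) R) : Matrix (Fin 3) (Fin 3) R) = H :=
    mem_unitaryGroup_iff.mp γ.2
  have hγG' : ((((γ : GL (Fin 3) R)) : Matrix (Fin 3) (Fin 3) R).map σ)ᵀ * G' * ((γ : GL (Fin 3) R) : Matrix (Fin 3) (Fin 3) R) = G' :=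
    twistGram_invariant σ H hg
  have q00 : Q 0 0 = 0 := frameGram_apply_eq_zero_of_isUnit σ hγH hP h00
  have q01 : Q 0 1 = 0 := frameGram_apply_eq_zero_of_isUnit σ hγH hP h01
  have q10 : Q 1 0 = 0 := frameGram_apply_eq_zero_of_isUnit σ hγH hP h10
  have q12 : Q 1 2 = 0 := frameGram_apply_eq_zero_of_isUnit σ hγH hP h12
  have q21 : Q 2 1 = 0 := frameGram_apply_eq_zero_of_isUnit σ hγH hP h21
  have q22 : Q 2 2 = 0 := frameGram_apply_eq_zero_of_isUnit σ hγH hP h22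
  have q'00 : Q' 0 0 = 0 := frameGram_apply_eq_zero_of_isUnit σ hγG' hP h00
  have q'01 : Q' 0 1 = 0 := frameGram_apply_eq_zero_of_isUnit σ hγG' hP h01
  have q'10 : Q' 1 0 = 0 := frameGram_apply_eq_zero_of_isUnit σ hγG' hP h10
  have q'12 : Q' 1 2 = 0 := frameGram_apply_eq_zero_of_isUnit σ hγG' hP h12
  have q'21 : Q' 2 1 = 0 := frameGram_apply_eq_zero_of_isUnit σ hγG' hP h21
  have q'22 : Q' 2 2 = 0 := frameGram_apply_eq_zero_of_isUnit σ hγG' hP h22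
  -- `Q = H_P`, `Q′ = H_{gP}` as transported forms; both hermitian
  have hQtw : Q = twistGram σ H Pm := rfl
  have hQ'tw : Q' = twistGram σ H (((g : GL (Fin 3) R) : Matrix (Fin 3) (Fin 3) R) * Pm) := by
    rw [hQ', twistGram_mul, hG']
  have hQh : (Q.map σ)ᵀ = Q := by rw [hQtw]; exact conjTranspose_twistGram σ H hσ hH _
  have hQ'h : (Q'.map σ)ᵀ = Q' := by rw [hQ'tw]; exact conjTranspose_twistGram σ H hσ hH _
  have q20 : Q 2 0 = σ (Q 0 2) := by nth_rw 1 [← hQh]; rfl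
  have q'20 : Q' 2 0 = σ (Q' 0 2) := by nth_rw 1 [← hQ'h]; rfl
  -- determinants: `det Q = −c x σ(c) = σ(det P) det H det P`, `det Q′ = N(det g) det Q`
  have hdet3 : ∀ A : Matrix (Fin 3) (Fin 3) R, A 0 0 = 0 → A 0 1 = 0 → A 1 0 = 0 → A 1 2 = 0 → A 2 1 = 0 → A 2 2 = 0 →
      A.det = -(A 0 2 * A 1 1 * A 2 0) := by
    intro A a00 a01 a10 a12 a21 a22
    rw [Matrix.det_fin_three, a00, a01, a10, a12, a21, a22]
    ring
  have hdetQ : Q.det = -(Q 0 2 * Q 1 1 * Q 2 0) := hdet3 Q q00 q01 q10 q12 q21 q22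
  have hdetQ' : Q'.det = -(Q' 0 2 * Q' 1 1 * Q' 2 0) := hdet3 Q' q'00 q'01 q'10 q'12 q'21 q'22
  have hdettw : ∀ A : Matrix (Fin 3) (Fin 3) R, (twistGram σ H A).det = σ A.det * H.det * A.det := by
    intro A
    rw [twistGram_def, det_mul, det_mul, det_transpose, ← RingHom.mapMatrix_apply, ← RingHom.map_det]
  have hdP : IsUnit Pm.det := (Matrix.isUnit_iff_isUnit_det _).mp (Units.isUnit P)
  have hdg : IsUnit ((g : GL (Fin 3) R) : Matrix (Fin 3) (Fin 3) R).det := (Matrix.isUnit_iff_isUnit_det _).mp (Units.isUnit g)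
  have hQu : IsUnit (Q 0 2 * Q 1 1 * Q 2 0) := by
    have h1 : IsUnit Q.det := by
      rw [hQtw, hdettw]
      exact ((hdP.map σ).mul hHd).mul hdP
    rw [hdetQ, IsUnit.neg_iff] at h1
    exact h1
  have hQ'u : IsUnit (Q' 0 2 * Q' 1 1 * Q' 2 0) := by
    have h1 : IsUnit Q'.det := by
      rw [hQ'tw, hdettw, det_mul]
      exact (((hdg.mul hdP).map σ).mul hHd).mul (hdg.mul hdP)
    rw [hdetQ', IsUnit.neg_iff] at h1
    exact h1
  obtain ⟨hc, hx, he⟩ : IsUnit (Q 0 2) ∧ IsUnit (Q 1 1) ∧ IsUnit (Q 2 0) := by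
    simpa only [IsUnit.mul_iff, and_assoc] using hQu
  obtain ⟨hc', hx', he'⟩ : IsUnit (Q' 0 2) ∧ IsUnit (Q' 1 1) ∧ IsUnit (Q' 2 0) := by
    simpa only [IsUnit.mul_iff, and_assoc] using hQ'u
  -- the key relation `c′ x′ σ(c′) = N(det g) · c x σ(c)`
  have hkey : Q' 0 2 * Q' 1 1 * σ (Q' 0 2) =
      σ (((g : GL (Fin 3) R) : Matrix (Fin 3) (Fin 3) R).det) * ((g : GL (Fin 3) R) : Matrix (Fin 3) (Fin 3) R).det *
        (Q 0 2 * Q 1 1 * σ (Q 0 2)) := by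
    have h1 : Q'.det = σ (((g : GL (Fin 3) R) : Matrix (Fin 3) (Fin 3) R).det) *
        ((g : GL (Fin 3) R) : Matrix (Fin 3) (Fin 3) R).det * Q.det := by
      rw [hQ'tw, hQtw, hdettw, hdettw, det_mul, map_mul]
      ring
    rw [hdetQ, hdetQ', q20, q'20] at h1
    linear_combination -h1
  -- Step C: the diagonal correction `S = diag(1, c′/(c·det g), c/c′)` in the frame
  have hPPi : Pm * Pi = 1 := by rw [hPm, hPi, ← Units.val_mul, mul_inv_cancel, Units.val_one]
  have hPiP : Pi * Pm = 1 := by rw [hPm, hPi, ← Units.val_mul, inv_mul_cancel, Units.val_one]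
  set w : Rˣ := hc.unit * hdg.unit with hw
  have hwval : (w : R) = Q 0 2 * ((g : GL (Fin 3) R) : Matrix (Fin 3) (Fin 3) R).det := by
    rw [hw, Units.val_mul, hc.unit_spec, hdg.unit_spec]
  have hw2 : ((w⁻¹ : Rˣ) : R) * (Q 0 2 * ((g : GL (Fin 3) R) : Matrix (Fin 3) (Fin 3) R).det) = 1 := by
    rw [← hwval, Units.inv_mul]
  have hσw2 : σ ((w⁻¹ : Rˣ) : R) * (σ (Q 0 2) * σ ((g : GL (Fin 3) R) : Matrix (Fin 3) (Fin 3) R).det) = 1 := by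
    rw [← map_mul, ← map_mul, hw2, map_one]
  set su : Fin 3 → Rˣ := ![1, hc'.unit * w⁻¹, hc.unit * hc'.unit⁻¹] with hsu
  set S : Matrix (Fin 3) (Fin 3) R := diagonal fun i => ((su i : Rˣ) : R) with hS
  set Si : Matrix (Fin 3) (Fin 3) R := diagonal fun i => (((su i)⁻¹ : Rˣ) : R) with hSi
  have hSSi : S * Si = 1 := by
    rw [hS, hSi, diagonal_mul_diagonal, ← diagonal_one]
    congr 1
    funext i
    exact Units.mul_inv _
  have hSiS : Si * S = 1 := by
    rw [hS, hSi, diagonal_mul_diagonal, ← diagonal_one]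
    congr 1
    funext i
    exact Units.inv_mul _
  let Sg : GL (Fin 3) R := ⟨S, Si, hSSi, hSiS⟩
  -- the three non-trivial entries of `ᵗ(σS) Q′ S = Q`
  have e02 : σ ((su 0 : Rˣ) : R) * Q' 0 2 * ((su 2 : Rˣ) : R) = Q 0 2 := by
    simp only [hsu, Matrix.cons_val_zero, Matrix.cons_val_two, Matrix.tail_cons, Matrix.head_cons, Units.val_one, map_one,
      one_mul, Units.val_mul, hc.unit_spec]
    calc Q' 0 2 * (Q 0 2 * ((hc'.unit⁻¹ : Rˣ) : R)) = Q 0 2 * (Q' 0 2 * ((hc'.unit⁻¹ : Rˣ) : R)) := by ring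
      _ = Q 0 2 := by rw [hc'.mul_val_inv, mul_one]
  have e20 : σ ((su 2 : Rˣ) : R) * Q' 2 0 * ((su 0 : Rˣ) : R) = Q 2 0 := by
    simp only [hsu, Matrix.cons_val_zero, Matrix.cons_val_two, Matrix.tail_cons, Matrix.head_cons, Units.val_one,
      mul_one, Units.val_mul, hc.unit_spec, q20, q'20, ← map_mul]
    congr 1
    calc Q 0 2 * ((hc'.unit⁻¹ : Rˣ) : R) * Q' 0 2 = Q 0 2 * (Q' 0 2 * ((hc'.unit⁻¹ : Rˣ) : R)) := by ring
      _ = Q 0 2 := by rw [hc'.mul_val_inv, mul_one]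
  have hsu1 : su 1 = hc'.unit * w⁻¹ := rfl
  have e11 : σ ((su 1 : Rˣ) : R) * Q' 1 1 * ((su 1 : Rˣ) : R) = Q 1 1 := by
    rw [hsu1, Units.val_mul, hc'.unit_spec, map_mul]
    linear_combination (σ ((w⁻¹ : Rˣ) : R) * ((w⁻¹ : Rˣ) : R)) * hkey +
      (Q 1 1 * (σ ((w⁻¹ : Rˣ) : R) * (σ (Q 0 2) * σ ((g : GL (Fin 3) R) : Matrix (Fin 3) (Fin 3) R).det))) * hw2 + Q 1 1 * hσw2
  have hSQS : (S.map σ)ᵀ * Q' * S = Q := by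
    rw [hS, diagonal_map (map_zero σ), diagonal_transpose]
    ext i j
    rw [mul_diagonal, diagonal_mul]
    fin_cases i <;> fin_cases j
    · simp [q00, q'00]
    · simp [q01, q'01]
    · simpa using e02
    · simp [q10, q'10]
    · simpa using e11
    · simp [q12, q'12]
    · simpa using e20
    · simp [q21, q'21]
    · simp [q22, q'22]
  refine ⟨P * Sg * P⁻¹, ?_, ?_⟩
  · -- `t` commutes with `γ = P · diag(d) · P⁻¹`
    apply Units.ext
    simp only [Units.val_mul]
    change Pm * S * Pi * ((γ : GL (Fin 3) R) : Matrix (Fin 3) (Fin 3) R) = ((γ : GL (Fin 3) R) : Matrix (Fin 3) (Fin 3) R) * (Pm * S * Pi)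
    have hγeq : ((γ : GL (Fin 3) R) : Matrix (Fin 3) (Fin 3) R) = Pm * diagonal d * Pi := by
      calc ((γ : GL (Fin 3) R) : Matrix (Fin 3) (Fin 3) R)
          = ((γ : GL (Fin 3) R) : Matrix (Fin 3) (Fin 3) R) * (Pm * Pi) := by rw [hPPi, Matrix.mul_one]
        _ = ((γ : GL (Fin 3) R) : Matrix (Fin 3) (Fin 3) R) * Pm * Pi := by rw [Matrix.mul_assoc]
        _ = Pm * diagonal d * Pi := by rw [hP]
    have hSD : S * diagonal d = diagonal d * S := by
      rw [hS, diagonal_mul_diagonal, diagonal_mul_diagonal]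
      congr 1
      funext i
      exact mul_comm _ _
    rw [hγeq]
    calc Pm * S * Pi * (Pm * diagonal d * Pi) = Pm * S * (Pi * Pm) * diagonal d * Pi := by simp only [Matrix.mul_assoc]
      _ = Pm * (S * diagonal d) * Pi := by rw [hPiP, Matrix.mul_one]; simp only [Matrix.mul_assoc]
      _ = Pm * (diagonal d * S) * Pi := by rw [hSD]
      _ = Pm * diagonal d * (Pi * Pm) * S * Pi := by rw [hPiP, Matrix.mul_one]; simp only [Matrix.mul_assoc]
      _ = Pm * diagonal d * Pi * (Pm * S * Pi) := by simp only [Matrix.mul_assoc]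
  · -- `ᵗ(σt) H_g t = H`
    simp only [Units.val_mul]
    change (((Pm * S * Pi).map σ)ᵀ) * G' * (Pm * S * Pi) = H
    have hQ'G : twistGram σ G' Pm = Q' := rfl
    rw [← twistGram_def, twistGram_mul, twistGram_mul, hQ'G, hSQS, hQtw, ← twistGram_mul, hPPi, twistGram_one]

end Three

/-! ## §3 `N = 2`: the split torus `T ≅ E^×` of `U(1,1)` -/

section Two

variable {R : Type*} [CommRing R] (σ : R →+* R) (H : Matrix (Fin 2) (Fin 2) R)

/-- **ONE CLASS IN THE STABLE CLASS ON THE SPLIT-TORUS STRATUM (`N = 2`)** — the `U(2)`-factor of the endoscopic group: if `γ ∈ U(H)(R)`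
(`H` σ-hermitian with unit determinant, `σ` an involution) has an eigenframe `γ P = P · diag(d₀, d₁)` with `σ(d₀) d₀ − 1` and
`σ(d₁) d₁ − 1` UNITS (for `d = (α, σ(α)⁻¹)`: `N(α) ≠ 1` at every factor — the SPLIT torus `T ≅ E^×` of `U(1,1)`), then every
`δ ∈ U(H)(R)` stably conjugate to `γ` is `U(H)(R)`-conjugate to `γ`: both frame Gram matrices are `[[0,c],[σc,0]]` (a hyperbolic
plane), and `t = P · diag(1, c∕c′) · P⁻¹ ∈ Z(γ)` carries `H_g` to `H` — no norm condition in rank `2`. [cite: Rogawski1990, §3.1 p. 19; §3.6 p. 31]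
[cite: Kottwitz1986, §7] -/
theorem isConj_of_isStablyConj_of_splitFrame_two (hσ : ∀ r : R, σ (σ r) = r) (hH : (H.map σ)ᵀ = H) (hHd : IsUnit H.det)
    {γ δ : unitaryGroup σ H} (h : IsStablyConj σ H γ δ) (P : GL (Fin 2) R) {d : Fin 2 → R}
    (hP : ((γ : GL (Fin 2) R) : Matrix (Fin 2) (Fin 2) R) * (P : Matrix (Fin 2) (Fin 2) R) =
      (P : Matrix (Fin 2) (Fin 2) R) * diagonal d)
    (h00 : IsUnit (σ (d 0) * d 0 - 1)) (h11 : IsUnit (σ (d 1) * d 1 - 1)) :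
    IsConj γ δ := by
  obtain ⟨g, hg⟩ := isStablyConj_iff.mp h
  suffices hs : ∃ t : GL (Fin 2) R, t * (γ : GL (Fin 2) R) = γ * t ∧
      ((t : Matrix (Fin 2) (Fin 2) R).map σ)ᵀ * twistGram σ H ((g : GL (Fin 2) R) : Matrix (Fin 2) (Fin 2) R) *
        (t : Matrix (Fin 2) (Fin 2) R) = H by
    obtain ⟨u, hu, huc⟩ := (exists_unitary_conj_iff_exists_commute_congr_eq σ H hg).2 hs
    refine isConj_iff.2 ⟨⟨u, hu⟩, Subtype.ext ?_⟩
    simpa using huc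
  set Pm : Matrix (Fin 2) (Fin 2) R := (P : Matrix (Fin 2) (Fin 2) R) with hPm
  set Pi : Matrix (Fin 2) (Fin 2) R := ((P⁻¹ : GL (Fin 2) R) : Matrix (Fin 2) (Fin 2) R) with hPi
  set G' : Matrix (Fin 2) (Fin 2) R := twistGram σ H ((g : GL (Fin 2) R) : Matrix (Fin 2) (Fin 2) R) with hG'
  set Q : Matrix (Fin 2) (Fin 2) R := (Pm.map σ)ᵀ * H * Pm with hQ
  set Q' : Matrix (Fin 2) (Fin 2) R := (Pm.map σ)ᵀ * G' * Pm with hQ'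
  have hγH : ((((γ : GL (Fin 2) R)) : Matrix (Fin 2) (Fin 2) R).map σ)ᵀ * H * ((γ : GL (Fin 2) R) : Matrix (Fin 2) (Fin 2) R) = H :=
    mem_unitaryGroup_iff.mp γ.2
  have hγG' : ((((γ : GL (Fin 2) R)) : Matrix (Fin 2) (Fin 2) R).map σ)ᵀ * G' * ((γ : GL (Fin 2) R) : Matrix (Fin 2) (Fin 2) R) = G' :=
    twistGram_invariant σ H hg
  have q00 : Q 0 0 = 0 := frameGram_apply_eq_zero_of_isUnit σ hγH hP h00
  have q11 : Q 1 1 = 0 := frameGram_apply_eq_zero_of_isUnit σ hγH hP h11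
  have q'00 : Q' 0 0 = 0 := frameGram_apply_eq_zero_of_isUnit σ hγG' hP h00
  have q'11 : Q' 1 1 = 0 := frameGram_apply_eq_zero_of_isUnit σ hγG' hP h11
  have hQtw : Q = twistGram σ H Pm := rfl
  have hQ'tw : Q' = twistGram σ H (((g : GL (Fin 2) R) : Matrix (Fin 2) (Fin 2) R) * Pm) := by
    rw [hQ', twistGram_mul, hG']
  have hQh : (Q.map σ)ᵀ = Q := by rw [hQtw]; exact conjTranspose_twistGram σ H hσ hH _
  have hQ'h : (Q'.map σ)ᵀ = Q' := by rw [hQ'tw]; exact conjTranspose_twistGram σ H hσ hH _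
  have q10 : Q 1 0 = σ (Q 0 1) := by nth_rw 1 [← hQh]; rfl
  have q'10 : Q' 1 0 = σ (Q' 0 1) := by nth_rw 1 [← hQ'h]; rfl
  have hdettw : ∀ A : Matrix (Fin 2) (Fin 2) R, (twistGram σ H A).det = σ A.det * H.det * A.det := by
    intro A
    rw [twistGram_def, det_mul, det_mul, det_transpose, ← RingHom.mapMatrix_apply, ← RingHom.map_det]
  have hdP : IsUnit Pm.det := (Matrix.isUnit_iff_isUnit_det _).mp (Units.isUnit P)
  have hdg : IsUnit ((g : GL (Fin 2) R) : Matrix (Fin 2) (Fin 2) R).det := (Matrix.isUnit_iff_isUnit_det _).mp (Units.isUnit g)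
  have hc : IsUnit (Q 0 1) := by
    have h1 : IsUnit Q.det := by
      rw [hQtw, hdettw]
      exact ((hdP.map σ).mul hHd).mul hdP
    rw [Matrix.det_fin_two, q00, q11, zero_mul, zero_sub, IsUnit.neg_iff, IsUnit.mul_iff] at h1
    exact h1.1
  have hc' : IsUnit (Q' 0 1) := by
    have h1 : IsUnit Q'.det := by
      rw [hQ'tw, hdettw, det_mul]
      exact (((hdg.mul hdP).map σ).mul hHd).mul (hdg.mul hdP)
    rw [Matrix.det_fin_two, q'00, q'11, zero_mul, zero_sub, IsUnit.neg_iff, IsUnit.mul_iff] at h1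
    exact h1.1
  have hPPi : Pm * Pi = 1 := by rw [hPm, hPi, ← Units.val_mul, mul_inv_cancel, Units.val_one]
  have hPiP : Pi * Pm = 1 := by rw [hPm, hPi, ← Units.val_mul, inv_mul_cancel, Units.val_one]
  set su : Fin 2 → Rˣ := ![1, hc.unit * hc'.unit⁻¹] with hsu
  set S : Matrix (Fin 2) (Fin 2) R := diagonal fun i => ((su i : Rˣ) : R) with hS
  set Si : Matrix (Fin 2) (Fin 2) R := diagonal fun i => (((su i)⁻¹ : Rˣ) : R) with hSi
  have hSSi : S * Si = 1 := by
    rw [hS, hSi, diagonal_mul_diagonal, ← diagonal_one]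
    congr 1
    funext i
    exact Units.mul_inv _
  have hSiS : Si * S = 1 := by
    rw [hS, hSi, diagonal_mul_diagonal, ← diagonal_one]
    congr 1
    funext i
    exact Units.inv_mul _
  let Sg : GL (Fin 2) R := ⟨S, Si, hSSi, hSiS⟩
  have hsu0 : su 0 = 1 := rfl
  have hsu1 : su 1 = hc.unit * hc'.unit⁻¹ := rfl
  have e01 : σ ((su 0 : Rˣ) : R) * Q' 0 1 * ((su 1 : Rˣ) : R) = Q 0 1 := by
    rw [hsu0, hsu1, Units.val_one, map_one, one_mul, Units.val_mul, hc.unit_spec]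
    calc Q' 0 1 * (Q 0 1 * ((hc'.unit⁻¹ : Rˣ) : R)) = Q 0 1 * (Q' 0 1 * ((hc'.unit⁻¹ : Rˣ) : R)) := by ring
      _ = Q 0 1 := by rw [hc'.mul_val_inv, mul_one]
  have e10 : σ ((su 1 : Rˣ) : R) * Q' 1 0 * ((su 0 : Rˣ) : R) = Q 1 0 := by
    rw [hsu0, hsu1, Units.val_one, mul_one, Units.val_mul, hc.unit_spec, q10, q'10, ← map_mul]
    congr 1
    calc Q 0 1 * ((hc'.unit⁻¹ : Rˣ) : R) * Q' 0 1 = Q 0 1 * (Q' 0 1 * ((hc'.unit⁻¹ : Rˣ) : R)) := by ring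
      _ = Q 0 1 := by rw [hc'.mul_val_inv, mul_one]
  have hSQS : (S.map σ)ᵀ * Q' * S = Q := by
    rw [hS, diagonal_map (map_zero σ), diagonal_transpose]
    ext i j
    rw [mul_diagonal, diagonal_mul]
    fin_cases i <;> fin_cases j
    · simp [q00, q'00]
    · simpa using e01
    · simpa using e10
    · simp [q11, q'11]
  refine ⟨P * Sg * P⁻¹, ?_, ?_⟩
  · apply Units.ext
    simp only [Units.val_mul]
    change Pm * S * Pi * ((γ : GL (Fin 2) R) : Matrix (Fin 2) (Fin 2) R) = ((γ : GL (Fin 2) R) : Matrix (Fin 2) (Fin 2) R) * (Pm * S * Pi)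
    have hγeq : ((γ : GL (Fin 2) R) : Matrix (Fin 2) (Fin 2) R) = Pm * diagonal d * Pi := by
      calc ((γ : GL (Fin 2) R) : Matrix (Fin 2) (Fin 2) R)
          = ((γ : GL (Fin 2) R) : Matrix (Fin 2) (Fin 2) R) * (Pm * Pi) := by rw [hPPi, Matrix.mul_one]
        _ = ((γ : GL (Fin 2) R) : Matrix (Fin 2) (Fin 2) R) * Pm * Pi := by rw [Matrix.mul_assoc]
        _ = Pm * diagonal d * Pi := by rw [hP]
    have hSD : S * diagonal d = diagonal d * S := by
      rw [hS, diagonal_mul_diagonal, diagonal_mul_diagonal]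
      congr 1
      funext i
      exact mul_comm _ _
    rw [hγeq]
    calc Pm * S * Pi * (Pm * diagonal d * Pi) = Pm * S * (Pi * Pm) * diagonal d * Pi := by simp only [Matrix.mul_assoc]
      _ = Pm * (S * diagonal d) * Pi := by rw [hPiP, Matrix.mul_one]; simp only [Matrix.mul_assoc]
      _ = Pm * (diagonal d * S) * Pi := by rw [hSD]
      _ = Pm * diagonal d * (Pi * Pm) * S * Pi := by rw [hPiP, Matrix.mul_one]; simp only [Matrix.mul_assoc]
      _ = Pm * diagonal d * Pi * (Pm * S * Pi) := by simp only [Matrix.mul_assoc]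
  · simp only [Units.val_mul]
    change (((Pm * S * Pi).map σ)ᵀ) * G' * (Pm * S * Pi) = H
    have hQ'G : twistGram σ G' Pm = Q' := rfl
    rw [← twistGram_def, twistGram_mul, twistGram_mul, hQ'G, hSQS, hQtw, ← twistGram_mul, hPPi, twistGram_one]

end Two

end Literature.NumberTheory.Rogawski1990

end
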